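import Literature.NumberTheory.Automorphic.UnitaryGroupSymplecticEmbedding
import Literature.NumberTheory.Automorphic.UnitaryGroupCayley
import Literature.LinearAlgebra.Semilinear.RankOneHermitianRigidityQuadratic
import Literature.LinearAlgebra.Matrix.DetLinearFamilyMvPolynomial
import Mathlib.LinearAlgebra.Matrix.SesquilinearForm
import Mathlib.LinearAlgebra.Matrix.ToLin
import HarnessLib

/-!
# The Cayley family of a unitary group over a quadratic algebra and its quadratic moment map

Topic `NumberTheory/Automorphic`; namespace `Literature.NumberTheory.Automorphic.UnitaryGroup` (continues
`UnitaryGroupSymplecticEmbedding`, `UnitaryGroupCayley`).  Definitions with bodies and proved theorems; no named fact,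
no record, no `sorry`.

Setting: quadratic coordinates `IsQuadraticCoordinates (algebraMap F₀ K) Ψ δ d` (`K = F₀ ⊕ F₀ δ`), the conjugation
`σ` (`σ ∘ algebraMap = algebraMap`, `σ δ = −δ`, `σ² = 1`), a symmetric `F₀`-rational Gram matrix `T` with `det T` a unit,
`H = T ⊗ 1`, the hermitian pairing `h(x, y) = (σ x)ᵀ H y` (`hermForm`) on `V = Kⁿ` with unitary group
`unitaryGroupOfForm σ H`, and the restriction-of-scalars dictionary `resEnd`, `reIm`, `im h = alt (polar β_T)` of
`UnitaryGroupSymplecticEmbedding`.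

* §1 (any commutative ring) the `h`-ADJOINT `M^* = H⁻¹ (σ M)ᵀ H` (`adjMatrix`) and the skew part `M − M^*` (`skewPart`),
  which is SKEW-ADJOINT: `(σ c)ᵀ H = −H c` (`transpose_map_skewPart_mul`); the sesquilinear form
  `B_H = Matrix.toLinearMapₛₗ₂' σ id H` is `hermForm` (`toLinearMapₛₗ₂'_eq_hermForm`), hermitian, non-degenerate, and a
  `B_H`-self-adjoint endomorphism has a self-adjoint matrix (`transpose_map_toMatrix'_of_selfAdjoint`).
* §2 the LINEAR FAMILY of skew-adjoint matrices `c_t = 2 (M_t − M_t^*)`, `M_t` the matrix with coordinates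
  `t : n × n × Fin 2 → F₀` (`coordMatrix`, `skewFamily`) — every skew-adjoint matrix is in it up to the factor — its
  CAYLEY TRANSFORMS `γ_t = (c_t − 1)⁻¹ (c_t + 1) ∈ U(h)` (`cayleyFamily`, `cayleyFamily_transpose_mul_mul`, from
  `UnitaryGroupCayley`), the inverse-free relation `Res(c_t)(Res(γ_t) w − w) = Res(γ_t) w + w` on `F₀ⁿ × F₀ⁿ`
  (`resEnd_skewFamily_cayley`) with `w ↦ Res(γ_t) w − w` surjective, and the GENERICITY POLYNOMIAL: a non-zero
  `p ∈ F₀[X_k]` with `p(t) ≠ 0 ↔ det(c_t − 1), det(c_t + 1)` units (`exists_mvPolynomial_skewFamily`; the tree's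
  `DetLinearFamilyMvPolynomial`, [Weyl1939, Ch. II §10]).
* §3 the QUADRATIC MOMENT MAP `Q(v) = (k ↦ im h(v, c_{e_k} v)) ∈ F₀^{n × n × 2}` (`momentMap`) with
  `Q(v) · t = im h(v, c_t v) = alt(polar β_T)(reIm v, Res(c_t) reIm v)` (`momentMap_dotProduct`,
  `alt_polar_reIm_resEnd`), and its RIGIDITY: `Q(v) = Q(v')` forces `v' = λ v` with `λ σ(λ) = 1`
  (`exists_smul_eq_of_momentMap_eq`; the tree's `Semilinear/RankOneHermitianRigidityQuadratic`, [Howe1979, §11]).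

This is the linear algebra of the «doubling + density» proof of [Howe1979, §11] / [MoeglinVignerasWaldspurger1987,
Chap. 3 IV.4 1) a)] for the compact member of a unitary dual pair (cell `hodgecm-mathlib`, KEY
`b4-howe-compact-irreducible`, fact `mvw_IV4_rankOne_irreducibleOrZero`): the Zariski-dense Cayley locus of `U(V)`
parametrised by its Lie algebra, and the separation of `E¹`-orbits in `V` by the quadratic forms `v ↦ h(v, c v)`.

## References
* [Weyl1939] H. Weyl, *The Classical Groups* (1939), Ch. II §10, Ch. VI §2.
* [Howe1979] R. Howe, *θ-series and invariant theory*, Proc. Symp. Pure Math. 33.1 (1979), §11.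
* [MoeglinVignerasWaldspurger1987] C. Mœglin, M.-F. Vignéras, J.-L. Waldspurger, LNM 1291 (1987), Chap. 3 IV.4.
-/

set_option autoImplicit false

open scoped Matrix

namespace Literature.NumberTheory.Automorphic.UnitaryGroup

open QuadraticCoordinates Literature.RepresentationTheory.HeisenbergGroup

/-! ## §1 Adjoint and skew part for a form matrix -/

section Adjoint

variable {S : Type*} [CommRing S] {n : Type*} [Fintype n] [DecidableEq n] (σ : S →+* S) (H : Matrix n n S)

/-- the `h`-ADJOINT of a matrix: `M^* = H⁻¹ (σ M)ᵀ H`, so that `h(M u, w) = h(u, M^* w)` for `h(x,y) = (σ x)ᵀ H y`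
(`det H` a unit). [cite: Weyl1939, Ch. II §10] -/
noncomputable def adjMatrix (M : Matrix n n S) : Matrix n n S := H⁻¹ * (M.map σ)ᵀ * H

/-- the SKEW PART `M − M^*` of a matrix (skew-adjoint when `σ` is an involution and `H` hermitian).
[cite: Weyl1939, Ch. II §10] -/
noncomputable def skewPart (M : Matrix n n S) : Matrix n n S := M - adjMatrix σ H M

/-- formula. [cite: Weyl1939, Ch. II §10] -/
theorem adjMatrix_def (M : Matrix n n S) : adjMatrix σ H M = H⁻¹ * (M.map σ)ᵀ * H := rfl

/-- formula. [cite: Weyl1939, Ch. II §10] -/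
theorem skewPart_def (M : Matrix n n S) : skewPart σ H M = M - adjMatrix σ H M := rfl

/-- `(σ (H⁻¹))ᵀ H = 1` for `H` hermitian with `det H` a unit. [cite: Weyl1939, Ch. II §10] -/
theorem transpose_map_inv_mul_self (hH : (H.map σ)ᵀ = H) (hHd : IsUnit H.det) : ((H⁻¹).map σ)ᵀ * H = 1 := by
  rw [show ((H⁻¹).map σ)ᵀ * H = ((H⁻¹).map σ)ᵀ * (H.map σ)ᵀ by rw [hH], ← Matrix.transpose_mul, ← Matrix.map_mul,
    Matrix.mul_nonsing_inv _ hHd, Matrix.map_one σ (map_zero σ) (map_one σ), Matrix.transpose_one]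

/-- `(σ (H⁻¹))ᵀ = H⁻¹` for `H` hermitian with `det H` a unit. [cite: Weyl1939, Ch. II §10] -/
theorem transpose_map_inv (hH : (H.map σ)ᵀ = H) (hHd : IsUnit H.det) : ((H⁻¹).map σ)ᵀ = H⁻¹ :=
  (Matrix.inv_eq_left_inv (transpose_map_inv_mul_self σ H hH hHd)).symm

/-- `(σ M^*)ᵀ = H M H⁻¹` (`σ` an involution, `H` hermitian, `det H` a unit). [cite: Weyl1939, Ch. II §10] -/
theorem transpose_map_adjMatrix (hσ : ∀ x, σ (σ x) = x) (hH : (H.map σ)ᵀ = H) (hHd : IsUnit H.det) (M : Matrix n n S) :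
    ((adjMatrix σ H M).map σ)ᵀ = H * M * H⁻¹ := by
  have hMM : ((M.map σ)ᵀ).map σ = Mᵀ := by
    ext i j
    simp only [Matrix.map_apply, Matrix.transpose_apply, hσ]
  rw [adjMatrix_def, Matrix.map_mul, Matrix.map_mul, hMM, Matrix.transpose_mul, Matrix.transpose_mul,
    Matrix.transpose_transpose, transpose_map_inv σ H hH hHd, hH, Matrix.mul_assoc]

/-- **the skew part is skew-adjoint**: `(σ c)ᵀ H = −H c` for `c = M − M^*`. [cite: Weyl1939, Ch. II §10] -/
theorem transpose_map_skewPart_mul (hσ : ∀ x, σ (σ x) = x) (hH : (H.map σ)ᵀ = H) (hHd : IsUnit H.det)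
    (M : Matrix n n S) : ((skewPart σ H M).map σ)ᵀ * H = -(H * skewPart σ H M) := by
  rw [skewPart_def, Matrix.map_sub σ (map_sub σ), Matrix.transpose_sub, Matrix.sub_mul, transpose_map_adjMatrix σ H hσ hH hHd,
    Matrix.mul_assoc (H * M), Matrix.nonsing_inv_mul _ hHd, Matrix.mul_one, Matrix.mul_sub, adjMatrix_def,
    ← Matrix.mul_assoc H, ← Matrix.mul_assoc H, Matrix.mul_nonsing_inv _ hHd, Matrix.one_mul, neg_sub]

omit [DecidableEq n] in
/-- a scalar multiple of a skew-adjoint matrix is skew-adjoint, for scalars fixed by `σ`. [cite: Weyl1939, Ch. II §10] -/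
theorem transpose_map_smul_mul_of_skew {c : Matrix n n S} (hc : (c.map σ)ᵀ * H = -(H * c)) {a : S} (ha : σ a = a) :
    ((a • c).map σ)ᵀ * H = -(H * (a • c)) := by
  have : (a • c).map σ = a • c.map σ := by
    ext i j
    simp only [Matrix.map_apply, Matrix.smul_apply, smul_eq_mul, map_mul, ha]
  rw [this, Matrix.transpose_smul, Matrix.smul_mul, hc, Matrix.mul_smul, smul_neg]

/-- a self-adjoint matrix (`(σ A)ᵀ H = H A`) is its own adjoint. [cite: Weyl1939, Ch. II §10] -/
theorem adjMatrix_eq_self (hHd : IsUnit H.det) {A : Matrix n n S} (hA : (A.map σ)ᵀ * H = H * A) :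
    adjMatrix σ H A = A := by
  rw [adjMatrix_def, Matrix.mul_assoc, hA, ← Matrix.mul_assoc, Matrix.nonsing_inv_mul _ hHd, Matrix.one_mul]

/-- `(λ M)^* = σ(λ) M^*`. [cite: Weyl1939, Ch. II §10] -/
theorem adjMatrix_smul (a : S) (M : Matrix n n S) : adjMatrix σ H (a • M) = σ a • adjMatrix σ H M := by
  have : (a • M).map σ = σ a • M.map σ := by
    ext i j
    simp only [Matrix.map_apply, Matrix.smul_apply, smul_eq_mul, map_mul]
  rw [adjMatrix_def, adjMatrix_def, this, Matrix.transpose_smul, Matrix.mul_smul, Matrix.smul_mul]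

/-- `(M + M')^* = M^* + M'^*`. [cite: Weyl1939, Ch. II §10] -/
theorem adjMatrix_add (M M' : Matrix n n S) : adjMatrix σ H (M + M') = adjMatrix σ H M + adjMatrix σ H M' := by
  rw [adjMatrix_def, adjMatrix_def, adjMatrix_def, Matrix.map_add σ (map_add σ), Matrix.transpose_add, Matrix.mul_add,
    Matrix.add_mul]

/-- `skewPart` is additive. [cite: Weyl1939, Ch. II §10] -/
theorem skewPart_add (M M' : Matrix n n S) : skewPart σ H (M + M') = skewPart σ H M + skewPart σ H M' := by
  rw [skewPart_def, skewPart_def, skewPart_def, adjMatrix_add]; abel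

/-- `skewPart (a • M) = a • skewPart M` for `σ a = a`. [cite: Weyl1939, Ch. II §10] -/
theorem skewPart_smul {a : S} (ha : σ a = a) (M : Matrix n n S) : skewPart σ H (a • M) = a • skewPart σ H M := by
  rw [skewPart_def, skewPart_def, adjMatrix_smul, ha, smul_sub]

/-- `skewPart` of a finite sum. [cite: Weyl1939, Ch. II §10] -/
theorem skewPart_sum {ι : Type*} (s : Finset ι) (M : ι → Matrix n n S) :
    skewPart σ H (∑ i ∈ s, M i) = ∑ i ∈ s, skewPart σ H (M i) := by
  classical
  induction s using Finset.induction_on with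
  | empty => rw [Finset.sum_empty, Finset.sum_empty, skewPart_def, adjMatrix_def, Matrix.map_zero σ (map_zero σ),
      Matrix.transpose_zero, Matrix.mul_zero, Matrix.zero_mul, sub_zero]
  | insert i s hi ih => rw [Finset.sum_insert hi, Finset.sum_insert hi, skewPart_add, ih]

/-! ### The sesquilinear form `B_H` -/

/-- `B_H x y = (σ x)ᵀ H y = hermForm σ H x y`. [cite: Weyl1939, Ch. II §10] -/
theorem toLinearMapₛₗ₂'_eq_hermForm (x y : n → S) :
    Matrix.toLinearMapₛₗ₂' S σ (RingHom.id S) H x y = hermForm σ H x y := by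
  rw [Matrix.toLinearMapₛₗ₂'_apply, hermForm_apply]
  simp only [RingHom.id_apply, smul_eq_mul, dotProduct, Matrix.mulVec, Finset.mul_sum, Function.comp_apply]
  exact Finset.sum_congr rfl fun i _ => Finset.sum_congr rfl fun j _ => by ring

/-- `B_H` is hermitian when `H` is (`σ` an involution). [cite: Weyl1939, Ch. II §10] -/
theorem isSymm_toLinearMapₛₗ₂' (hσ : ∀ x, σ (σ x) = x) (hH : (H.map σ)ᵀ = H) :
    (Matrix.toLinearMapₛₗ₂' S σ (RingHom.id S) H).IsSymm := by
  have hJ' : ∀ i j, σ (H i j) = H j i := fun i j => by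
    have h := congrFun (congrFun hH j) i
    rwa [Matrix.transpose_apply, Matrix.map_apply] at h
  refine LinearMap.isSymm_def.2 fun x y => ?_
  rw [toLinearMapₛₗ₂'_eq_hermForm, toLinearMapₛₗ₂'_eq_hermForm, hermForm_apply, hermForm_apply]
  simp only [dotProduct, Matrix.mulVec, map_sum, map_mul, hσ, hJ', Finset.mul_sum, Function.comp_apply]
  rw [Finset.sum_comm]
  exact Finset.sum_congr rfl fun i _ => Finset.sum_congr rfl fun j _ => by ring

/-- `hermForm` is hermitian: `σ h(x, y) = h(y, x)`. [cite: Weyl1939, Ch. II §10] -/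
theorem conj_hermForm (hσ : ∀ x, σ (σ x) = x) (hH : (H.map σ)ᵀ = H) (x y : n → S) :
    σ (hermForm σ H x y) = hermForm σ H y x := by
  rw [← toLinearMapₛₗ₂'_eq_hermForm, ← toLinearMapₛₗ₂'_eq_hermForm]
  exact LinearMap.isSymm_def.1 (isSymm_toLinearMapₛₗ₂' σ H hσ hH) x y

omit [DecidableEq n] in
/-- `hermForm` is linear in the second variable: `h(x, a y) = a h(x, y)`. [cite: Weyl1939, Ch. II §10] -/
theorem hermForm_smul_right (x y : n → S) (a : S) : hermForm σ H x (a • y) = a * hermForm σ H x y := by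
  rw [hermForm_apply, hermForm_apply, Matrix.mulVec_smul, dotProduct_smul, smul_eq_mul]

omit [DecidableEq n] in
/-- `hermForm` and matrices: `h(x, M y) = (σ x)ᵀ (H M) y`. [cite: Weyl1939, Ch. II §10] -/
theorem hermForm_mulVec_right (x y : n → S) (M : Matrix n n S) :
    hermForm σ H x (M *ᵥ y) = (⇑σ ∘ x) ⬝ᵥ ((H * M) *ᵥ y) := by
  rw [hermForm_apply, Matrix.mulVec_mulVec]

/-- a `B_H`-self-adjoint endomorphism has a self-adjoint matrix: `(σ A)ᵀ H = H A`. [cite: Weyl1939, Ch. II §10] -/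
theorem transpose_map_toMatrix'_of_selfAdjoint (a : (n → S) →ₗ[S] (n → S))
    (ha : ∀ u w, Matrix.toLinearMapₛₗ₂' S σ (RingHom.id S) H (a u) w = Matrix.toLinearMapₛₗ₂' S σ (RingHom.id S) H u (a w)) :
    ((LinearMap.toMatrix' a).map σ)ᵀ * H = H * LinearMap.toMatrix' a := by
  ext i j
  have h := ha (Pi.single i 1) (Pi.single j 1)
  rw [toLinearMapₛₗ₂'_eq_hermForm, toLinearMapₛₗ₂'_eq_hermForm, hermForm_apply, hermForm_apply,
    ← Matrix.toLin'_toMatrix' a, Matrix.toLin'_apply, Matrix.toLin'_apply, Matrix.mulVec_mulVec] at h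
  have hσ1 : (⇑σ ∘ (Pi.single i (1 : S) : n → S)) = Pi.single i 1 := by
    funext k
    by_cases hk : k = i
    · subst hk; simp
    · simp [Pi.single_eq_of_ne hk]
  have hσM : (⇑σ ∘ (LinearMap.toMatrix' a *ᵥ (Pi.single i (1 : S) : n → S))) =
      (LinearMap.toMatrix' a).map σ *ᵥ Pi.single i 1 := by
    have e : (⇑σ ∘ (LinearMap.toMatrix' a *ᵥ (Pi.single i (1 : S) : n → S))) =
        (LinearMap.toMatrix' a).map σ *ᵥ (⇑σ ∘ (Pi.single i (1 : S) : n → S)) :=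
      funext fun k => RingHom.map_mulVec σ _ _ k
    rw [e, hσ1]
  rw [hσM, ← Matrix.vecMul_transpose, ← Matrix.dotProduct_mulVec, Matrix.mulVec_mulVec, hσ1, Matrix.mulVec_single_one,
    Matrix.mulVec_single_one, single_dotProduct, single_dotProduct, one_mul, one_mul, Matrix.col_apply,
    Matrix.col_apply] at h
  exact h

end Adjoint

/-! ## §2 The Cayley family over quadratic coordinates -/

section Family

variable {F₀ K : Type*} [Field F₀] [Field K] [Algebra F₀ K] {Ψ : (F₀ × F₀) ≃+ K} {δ : K} {d : F₀}
  (h : IsQuadraticCoordinates (algebraMap F₀ K) Ψ δ d) {σ : K →+* K}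
  (hσφ : ∀ a, σ (algebraMap F₀ K a) = algebraMap F₀ K a) (hσδ : σ δ = -δ) (hσσ : ∀ x, σ (σ x) = x)
  {n : Type*} [Fintype n] [DecidableEq n] {T : Matrix n n F₀} (hT : T.IsSymm) (hTd : IsUnit T.det)
  {H : Matrix n n K} (hH : H = T.map (algebraMap F₀ K))

omit [Fintype n] [DecidableEq n] in
/-- `H = T ⊗ 1` is hermitian: `(σ H)ᵀ = H`. [cite: Weyl1939, Ch. II §10] -/
theorem transpose_map_eq_of_eq_map (hσφ : ∀ a, σ (algebraMap F₀ K a) = algebraMap F₀ K a) (hT : T.IsSymm)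
    (hH : H = T.map (algebraMap F₀ K)) : (H.map σ)ᵀ = H := by
  rw [hH, Matrix.map_map, ← Matrix.transpose_map]
  have : (⇑σ ∘ ⇑(algebraMap F₀ K)) = algebraMap F₀ K := funext hσφ
  rw [this, hT]

/-- `det H` is a unit. [cite: Weyl1939, Ch. II §10] -/
theorem isUnit_det_of_eq_map (hTd : IsUnit T.det) (hH : H = T.map (algebraMap F₀ K)) : IsUnit H.det := by
  rw [hH, ← RingHom.mapMatrix_apply, ← RingHom.map_det]
  exact hTd.map _

variable (Ψ) in
/-- the matrix with coordinates `t`: `(M_t)_{ij} = Ψ (t(i,j,0), t(i,j,1)) = t(i,j,0) + t(i,j,1) δ`. [cite: Weyl1939, Ch. II §10] -/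
noncomputable def coordMatrix (t : n × n × Fin 2 → F₀) : Matrix n n K := fun i j => Ψ (t (i, j, 0), t (i, j, 1))

omit [Algebra F₀ K] [Fintype n] [DecidableEq n] in
/-- every matrix has coordinates. [cite: Weyl1939, Ch. II §10] -/
theorem coordMatrix_coords (M : Matrix n n K) :
    coordMatrix Ψ (fun k : n × n × Fin 2 => ![re Ψ (M k.1 k.2.1), im Ψ (M k.1 k.2.1)] k.2.2) = M := by
  ext i j
  simp only [coordMatrix, Matrix.cons_val_zero, Matrix.cons_val_one, Matrix.cons_val_fin_one, apply_re_im]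

include h in
/-- `coordMatrix` is a linear combination of the coordinates. [cite: Weyl1939, Ch. II §10] -/
theorem coordMatrix_eq_sum (t : n × n × Fin 2 → F₀) :
    coordMatrix Ψ t = ∑ k : n × n × Fin 2, algebraMap F₀ K (t k) • coordMatrix Ψ (Pi.single k 1) := by
  ext i j
  simp only [coordMatrix, Matrix.sum_apply, Matrix.smul_apply, smul_eq_mul, h.apply]
  have h01 : ((i, j, (0 : Fin 2)) : n × n × Fin 2) ≠ (i, j, 1) := by simp
  rw [Finset.sum_eq_add_of_mem (i, j, (0 : Fin 2)) (i, j, (1 : Fin 2)) (Finset.mem_univ _) (Finset.mem_univ _) h01]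
  · simp
  · rintro ⟨i', j', l⟩ - ⟨h0, h1⟩
    have hi0 : Pi.single (M := fun _ : n × n × Fin 2 => F₀) (i', j', l) (1 : F₀) (i, j, 0) = 0 :=
      Pi.single_eq_of_ne (Ne.symm h0) _
    have hi1 : Pi.single (M := fun _ : n × n × Fin 2 => F₀) (i', j', l) (1 : F₀) (i, j, 1) = 0 :=
      Pi.single_eq_of_ne (Ne.symm h1) _
    rw [hi0, hi1, map_zero, zero_mul, add_zero, mul_zero]

include h in
/-- the family is a linear combination of its values at the coordinate vectors. [cite: Weyl1939, Ch. II §10] -/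
theorem skewFamily_eq_sum' (σ' : K →+* K) (hσφ' : ∀ a, σ' (algebraMap F₀ K a) = algebraMap F₀ K a) (H' : Matrix n n K)
    (t : n × n × Fin 2 → F₀) :
    (2 : K) • skewPart σ' H' (coordMatrix Ψ t) =
      ∑ k : n × n × Fin 2, algebraMap F₀ K (t k) • ((2 : K) • skewPart σ' H' (coordMatrix Ψ (Pi.single k 1))) := by
  rw [coordMatrix_eq_sum h, skewPart_sum, Finset.smul_sum]
  refine Finset.sum_congr rfl fun k _ => ?_
  rw [skewPart_smul σ' H' (hσφ' (t k)), smul_comm]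

variable (Ψ σ H) in
/-- the LINEAR FAMILY OF SKEW-ADJOINT MATRICES `c_t = 2 (M_t − M_t^*)`. [cite: Weyl1939, Ch. II §10] -/
noncomputable def skewFamily (t : n × n × Fin 2 → F₀) : Matrix n n K := (2 : K) • skewPart σ H (coordMatrix Ψ t)

include h hσφ in
/-- **linearity of the family**: `c_t = Σ_k t_k c_{e_k}`. [cite: Weyl1939, Ch. II §10] -/
theorem skewFamily_eq_sum (t : n × n × Fin 2 → F₀) :
    skewFamily Ψ σ H t = ∑ k : n × n × Fin 2, algebraMap F₀ K (t k) • skewFamily Ψ σ H (Pi.single k 1) :=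
  skewFamily_eq_sum' h σ hσφ H t

variable (Ψ σ H) in
/-- the CAYLEY FAMILY `γ_t = (c_t − 1)⁻¹ (c_t + 1)`. [cite: Weyl1939, Ch. II §10] -/
noncomputable def cayleyFamily (t : n × n × Fin 2 → F₀) : Matrix n n K :=
  (skewFamily Ψ σ H t - 1)⁻¹ * (skewFamily Ψ σ H t + 1)

include hσφ hσσ hT hTd hH in
/-- `c_t` is skew-adjoint. [cite: Weyl1939, Ch. II §10] -/
theorem transpose_map_skewFamily_mul (t : n × n × Fin 2 → F₀) :
    ((skewFamily Ψ σ H t).map σ)ᵀ * H = -(H * skewFamily Ψ σ H t) := by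
  have h2 : σ (2 : K) = 2 := map_ofNat σ 2
  exact transpose_map_smul_mul_of_skew σ H
    (transpose_map_skewPart_mul σ H hσσ (transpose_map_eq_of_eq_map hσφ hT hH) (isUnit_det_of_eq_map hTd hH) _) h2

include hσφ hσσ hT hTd hH in
/-- **`γ_t ∈ U(h)`**: `(σ γ_t)ᵀ H γ_t = H` whenever `det (c_t ∓ 1)` are units. [cite: Weyl1939, Ch. II §10] -/
theorem cayleyFamily_transpose_mul_mul (t : n × n × Fin 2 → F₀) (hm : IsUnit (skewFamily Ψ σ H t - 1).det)
    (hp : IsUnit (skewFamily Ψ σ H t + 1).det) :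
    ((cayleyFamily Ψ σ H t).map σ)ᵀ * H * cayleyFamily Ψ σ H t = H :=
  cayley_transpose_mul_mul σ H _ (transpose_map_skewFamily_mul hσφ hσσ hT hTd hH t) hm hp

omit [Algebra F₀ K] in
/-- `γ_t` is invertible. [cite: Weyl1939, Ch. II §10] -/
theorem isUnit_cayleyFamily (t : n × n × Fin 2 → F₀) (hm : IsUnit (skewFamily Ψ σ H t - 1).det)
    (hp : IsUnit (skewFamily Ψ σ H t + 1).det) : IsUnit (cayleyFamily Ψ σ H t) :=
  isUnit_cayley _ hm hp

/-! ### The relation on `F₀ⁿ × F₀ⁿ` -/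

include h in
/-- `resEnd` is additive (it is a ring homomorphism read through `toLin'`). [cite: Weyl1939, Ch. II §10] -/
theorem resEnd_add (M M' : Matrix n n K) : h.resEnd n (M + M') = h.resEnd n M + h.resEnd n M' := by
  refine LinearMap.ext fun p => ?_
  rw [LinearMap.add_apply, h.resEnd_apply, h.resEnd_apply, h.resEnd_apply, map_add, Matrix.add_mulVec, map_add]

include h in
/-- `resEnd` is compatible with subtraction. [cite: Weyl1939, Ch. II §10] -/
theorem resEnd_sub (M M' : Matrix n n K) : h.resEnd n (M - M') = h.resEnd n M - h.resEnd n M' := by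
  rw [eq_sub_iff_add_eq, ← resEnd_add h, sub_add_cancel]

include h in
/-- **the Cayley relation in real coordinates**: `Res(c_t) (Res(γ_t) w − w) = Res(γ_t) w + w`.
[cite: Weyl1939, Ch. II §10] -/
theorem resEnd_skewFamily_cayley (t : n × n × Fin 2 → F₀) (hm : IsUnit (skewFamily Ψ σ H t - 1).det)
    (w : (n → F₀) × (n → F₀)) :
    h.resEnd n (skewFamily Ψ σ H t) (h.resEnd n (cayleyFamily Ψ σ H t) w - w) = h.resEnd n (cayleyFamily Ψ σ H t) w + w := by
  have key := congrArg (fun M => h.resEnd n M w) (cayley_mul_sub_one (skewFamily Ψ σ H t) hm)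
  simp only [map_mul, resEnd_sub h, resEnd_add h, map_one, Module.End.mul_apply, LinearMap.sub_apply,
    LinearMap.add_apply, Module.End.one_apply] at key
  rw [cayleyFamily]
  simp only [map_mul, resEnd_add h, map_one, Module.End.mul_apply, LinearMap.add_apply, Module.End.one_apply]
  exact key

include h in
/-- `w ↦ Res(γ_t) w − w` is surjective (`γ_t − 1 = 2 (c_t − 1)⁻¹` is invertible). [cite: Weyl1939, Ch. II §10] -/
theorem resEnd_cayleyFamily_sub_surjective [Invertible (2 : K)] (t : n × n × Fin 2 → F₀)
    (hm : IsUnit (skewFamily Ψ σ H t - 1).det) :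
    Function.Surjective fun w : (n → F₀) × (n → F₀) => h.resEnd n (cayleyFamily Ψ σ H t) w - w := by
  -- `γ - 1 = (c-1)⁻¹ ((c+1) - (c-1)) = (c-1)⁻¹ * 2`
  have hγ : cayleyFamily Ψ σ H t - 1 = (skewFamily Ψ σ H t - 1)⁻¹ * ((2 : K) • (1 : Matrix n n K)) := by
    have e : cayleyFamily Ψ σ H t - 1 =
        (skewFamily Ψ σ H t - 1)⁻¹ * (skewFamily Ψ σ H t + 1) - (skewFamily Ψ σ H t - 1)⁻¹ * (skewFamily Ψ σ H t - 1) := by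
      rw [cayleyFamily, Matrix.nonsing_inv_mul _ hm]
    rw [e, ← Matrix.mul_sub, add_sub_sub_cancel, ← two_smul K]
  have hu : IsUnit (cayleyFamily Ψ σ H t - 1) := by
    rw [hγ]
    refine (Matrix.isUnit_nonsing_inv_iff.2 ((Matrix.isUnit_iff_isUnit_det _).2 hm)).mul ?_
    rw [← Algebra.algebraMap_eq_smul_one]
    exact (isUnit_of_invertible (2 : K)).map _
  obtain ⟨u, hu'⟩ := hu
  intro w
  refine ⟨h.resEnd n (↑u⁻¹ : Matrix n n K) w, ?_⟩
  show h.resEnd n (cayleyFamily Ψ σ H t) (h.resEnd n (↑u⁻¹ : Matrix n n K) w) - h.resEnd n (↑u⁻¹ : Matrix n n K) w = w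
  have e1 : h.resEnd n (cayleyFamily Ψ σ H t) (h.resEnd n (↑u⁻¹ : Matrix n n K) w) - h.resEnd n (↑u⁻¹ : Matrix n n K) w =
      h.resEnd n (cayleyFamily Ψ σ H t - 1) (h.resEnd n (↑u⁻¹ : Matrix n n K) w) := by
    rw [resEnd_sub h, map_one, LinearMap.sub_apply, Module.End.one_apply]
  rw [e1, ← hu', ← Module.End.mul_apply, ← map_mul, Units.mul_inv, map_one, Module.End.one_apply]

/-! ### The genericity polynomial -/

include h hσφ in
/-- `c_t` read as an endomorphism is the point `t` of a linear family. [cite: Weyl1939, Ch. II §10] -/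
theorem toLin'_skewFamily (t : n × n × Fin 2 → F₀) :
    Matrix.toLin' (skewFamily Ψ σ H t) =
      (2 : K) • ∑ k : n × n × Fin 2, t k • Matrix.toLin' (skewPart σ H (coordMatrix Ψ (Pi.single k 1))) := by
  rw [skewFamily, map_smul, coordMatrix_eq_sum h, skewPart_sum, map_sum]
  congr 1
  refine Finset.sum_congr rfl fun k _ => ?_
  rw [skewPart_smul σ H (hσφ (t k)), map_smul, algebraMap_smul]

include h hσφ in
/-- **the genericity polynomial**: a non-zero `p ∈ F₀[X_k]` with `p(t) ≠ 0 ↔ det (c_t − 1), det (c_t + 1)` units.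
[cite: Weyl1939, Ch. II §10] -/
theorem exists_mvPolynomial_skewFamily [Module.Finite F₀ K] :
    ∃ p : MvPolynomial (n × n × Fin 2) F₀, p ≠ 0 ∧ ∀ t : n × n × Fin 2 → F₀,
      (MvPolynomial.eval t p ≠ 0 ↔ IsUnit (skewFamily Ψ σ H t - 1).det ∧ IsUnit (skewFamily Ψ σ H t + 1).det) := by
  obtain ⟨p, hp, he⟩ := Literature.LinearAlgebra.Matrix.exists_mvPolynomial_eval_ne_zero_iff_isUnit_tower (F := F₀)
    (E := K) (V := n → K) fun k : n × n × Fin 2 => Matrix.toLin' (skewPart σ H (coordMatrix Ψ (Pi.single k 1)))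
  have hu : ∀ X : Matrix n n K, IsUnit (Matrix.toLin' X) ↔ IsUnit X.det := fun X => by
    rw [← Matrix.isUnit_iff_isUnit_det]
    exact Matrix.isUnit_toLin'_iff
  refine ⟨p, hp, fun t => ?_⟩
  rw [he t, ← toLin'_skewFamily h hσφ, ← hu, ← hu, map_sub, map_add, Matrix.toLin'_one]
  rfl

end Family

/-! ## §3 The quadratic moment map and its rigidity -/

section Moment

variable {F₀ K : Type*} [Field F₀] [Field K] [Algebra F₀ K] {Ψ : (F₀ × F₀) ≃+ K} {δ : K} {d : F₀}
  (h : IsQuadraticCoordinates (algebraMap F₀ K) Ψ δ d) {σ : K →+* K}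
  (hσφ : ∀ a, σ (algebraMap F₀ K a) = algebraMap F₀ K a) (hσδ : σ δ = -δ) (hσσ : ∀ x, σ (σ x) = x)
  {n : Type*} [Fintype n] [DecidableEq n] {T : Matrix n n F₀} (hT : T.IsSymm) (hTd : IsUnit T.det)
  {H : Matrix n n K} (hH : H = T.map (algebraMap F₀ K))

include h hT hσφ hσδ hH in
/-- **`alt(polar β_T)(reIm v, Res(c) reIm v) = im h(v, c v)`**. [cite: Howe1979, §11] -/
theorem alt_polar_reIm_resEnd (c : Matrix n n K) (v : n → K) :
    alt (polar (Matrix.toLinearMap₂' F₀ T)) (reIm Ψ n v) (h.resEnd n c (reIm Ψ n v)) = im Ψ (hermForm σ H v (c *ᵥ v)) := by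
  rw [h.resEnd_reIm, hH, h.im_hermForm_map n hT hσφ hσδ]

variable (Ψ σ H) in
/-- the QUADRATIC MOMENT MAP `Q(v)_k = im h(v, c_{e_k} v)`. [cite: Howe1979, §11] -/
noncomputable def momentMap (v : n → K) : n × n × Fin 2 → F₀ := fun k =>
  im Ψ (hermForm σ H v (skewFamily Ψ σ H (Pi.single k 1) *ᵥ v))

include h hσφ in
/-- **`Q(v) · t = im h(v, c_t v)`** (linearity of the family). [cite: Howe1979, §11] -/
theorem momentMap_dotProduct (v : n → K) (t : n × n × Fin 2 → F₀) :
    momentMap Ψ σ H v ⬝ᵥ t = im Ψ (hermForm σ H v (skewFamily Ψ σ H t *ᵥ v)) := by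
  -- `X ↦ h(v, X v)` is `K`-linear
  let Z : Matrix n n K →ₗ[K] K :=
    (Matrix.toLinearMapₛₗ₂' K σ (RingHom.id K) H v) ∘ₗ (LinearMap.applyₗ v) ∘ₗ (Matrix.toLin' : Matrix n n K ≃ₗ[K] _).toLinearMap
  have hZ : ∀ X : Matrix n n K, Z X = hermForm σ H v (X *ᵥ v) := fun X => by
    simp only [Z, LinearMap.coe_comp, Function.comp_apply, LinearEquiv.coe_toLinearMap, LinearMap.applyₗ_apply_apply,
      Matrix.toLin'_apply, toLinearMapₛₗ₂'_eq_hermForm]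
  rw [← hZ, skewFamily_eq_sum h hσφ, map_sum, map_sum, dotProduct]
  refine Finset.sum_congr rfl fun k _ => ?_
  rw [map_smul, smul_eq_mul, h.im_map_mul, hZ, mul_comm]
  rfl

include h in
/-- an element fixed by `σ` with `im = 0`... precisely: `im (σ z) = −im z`, so `σ z = z` forces `im z = 0` (`2 ≠ 0`). [cite: Weyl1939, Ch. II §10] -/
theorem im_eq_zero_of_conj_eq (hσφ : ∀ a, σ (algebraMap F₀ K a) = algebraMap F₀ K a) (hσδ : σ δ = -δ) (h2 : (2 : F₀) ≠ 0)
    {z : K} (hz : σ z = z) : im Ψ z = 0 := by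
  have e := h.im_conj hσφ hσδ z
  rw [hz] at e
  have : (2 : F₀) * im Ψ z = 0 := by linear_combination e
  exact (mul_eq_zero.1 this).resolve_left h2

include h in
/-- `im (δ z) = re z`. [cite: Weyl1939, Ch. II §10] -/
theorem im_delta_mul (z : K) : im Ψ (δ * z) = re Ψ z := by
  rw [h.im_mul, h.re_delta, h.im_delta, zero_mul, zero_add, one_mul]

include h hσφ hσδ hσσ hT hTd hH in
/-- **rigidity of the moment map**: `Q(v) = Q(v')` forces `v' = λ v` with `λ σ(λ) = 1` (`2 ≠ 0` in `F₀`).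
[cite: Howe1979, §11] -/
theorem exists_smul_eq_of_momentMap_eq (h2 : (2 : F₀) ≠ 0) {v v' : n → K}
    (hvv' : momentMap Ψ σ H v = momentMap Ψ σ H v') : ∃ c : K, c * σ c = 1 ∧ v' = c • v := by
  have hHh := transpose_map_eq_of_eq_map hσφ hT hH
  have hHd := isUnit_det_of_eq_map hTd hH
  have h2K : (2 : K) ≠ 0 := by
    rw [show (2 : K) = algebraMap F₀ K 2 from (map_ofNat _ 2).symm]
    exact (map_ne_zero _).2 h2
  set B := Matrix.toLinearMapₛₗ₂' K σ (RingHom.id K) H with hB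
  have hS : B.IsSymm := isSymm_toLinearMapₛₗ₂' σ H hσσ hHh
  have hsep : B.SeparatingLeft := by
    intro x hx
    -- `(σ x)ᵀ H = 0` with `det H ≠ 0`
    have hv : Matrix.vecMul (⇑σ ∘ x) H = 0 := by
      funext j
      have := hx (Pi.single j 1)
      rwa [hB, toLinearMapₛₗ₂'_eq_hermForm, hermForm_apply, Matrix.dotProduct_mulVec, dotProduct_single, mul_one] at this
    have h0 := Matrix.eq_zero_of_vecMul_eq_zero hHd.ne_zero hv
    funext i
    have hi := congrFun h0 i
    rw [Function.comp_apply, Pi.zero_apply] at hi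
    rw [← hσσ (x i), hi, map_zero, Pi.zero_apply]
  refine Literature.LinearAlgebra.Semilinear.exists_smul_eq_of_forall_selfAdjoint_apply_self_eq B hσσ hS hsep
    fun a ha => ?_
  -- the self-adjoint matrix `A` of `a` and the parameter `t` with `c_t = 4 δ A`
  set A := LinearMap.toMatrix' a with hA
  have hAa : ∀ x, a x = A *ᵥ x := fun x => by rw [hA, ← Matrix.toLin'_apply, Matrix.toLin'_toMatrix']
  have hAadj : ((A.map σ)ᵀ) * H = H * A := transpose_map_toMatrix'_of_selfAdjoint σ H a ha
  have hskew : skewPart σ H (δ • A) = (2 * δ) • A := by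
    rw [skewPart_def, adjMatrix_smul, hσδ, adjMatrix_eq_self σ H hHd hAadj, neg_smul, sub_neg_eq_add, ← add_smul,
      ← two_mul]
  obtain ⟨t, ht⟩ : ∃ t : n × n × Fin 2 → F₀, coordMatrix Ψ t = δ • A := ⟨_, coordMatrix_coords (δ • A)⟩
  have hct : skewFamily Ψ σ H t = (4 * δ) • A := by
    rw [skewFamily, ht, hskew, smul_smul]; congr 1; ring
  -- `im h(v, c_t v) = 4 re h(v, A v)` and `h(v, A v)` is `σ`-fixed
  have hval : ∀ x : n → K, im Ψ (hermForm σ H x (skewFamily Ψ σ H t *ᵥ x)) = 4 * re Ψ (hermForm σ H x (A *ᵥ x)) := by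
    intro x
    rw [hct, Matrix.smul_mulVec, hermForm_smul_right, mul_assoc, mul_left_comm, im_delta_mul h,
      show (4 : K) = algebraMap F₀ K 4 from (map_ofNat _ 4).symm, h.re_map_mul]
  have hfix : ∀ x : n → K, σ (hermForm σ H x (A *ᵥ x)) = hermForm σ H x (A *ᵥ x) := by
    intro x
    rw [conj_hermForm σ H hσσ hHh, ← hAa, ← toLinearMapₛₗ₂'_eq_hermForm, ← toLinearMapₛₗ₂'_eq_hermForm, ← hB]
    exact ha x x
  have hre : ∀ x : n → K, hermForm σ H x (A *ᵥ x) = algebraMap F₀ K (re Ψ (hermForm σ H x (A *ᵥ x))) := by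
    intro x
    conv_lhs => rw [← h.re_add_im (hermForm σ H x (A *ᵥ x)), im_eq_zero_of_conj_eq h hσφ hσδ h2 (hfix x), map_zero,
      zero_mul, add_zero]
  have heq : im Ψ (hermForm σ H v (skewFamily Ψ σ H t *ᵥ v)) = im Ψ (hermForm σ H v' (skewFamily Ψ σ H t *ᵥ v')) := by
    rw [← momentMap_dotProduct h hσφ, ← momentMap_dotProduct h hσφ, hvv']
  rw [hval, hval] at heq
  have h4 : (4 : F₀) ≠ 0 := by
    have : (4 : F₀) = 2 * 2 := by norm_num
    rw [this]; exact mul_ne_zero h2 h2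
  have hre' : re Ψ (hermForm σ H v (A *ᵥ v)) = re Ψ (hermForm σ H v' (A *ᵥ v')) := mul_left_cancel₀ h4 heq
  -- conclude `B (a v) v = B (a v') v'`
  have e1 : B (a v) v = hermForm σ H v (A *ᵥ v) := by rw [ha, hB, toLinearMapₛₗ₂'_eq_hermForm, hAa]
  have e2 : B (a v') v' = hermForm σ H v' (A *ᵥ v') := by rw [ha, hB, toLinearMapₛₗ₂'_eq_hermForm, hAa]
  rw [e1, e2, hre v, hre v', hre']

end Moment

end Literature.NumberTheory.Automorphic.UnitaryGroup
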